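import Mathlib
import Summits.ResolutionOfSingularities.ResolutionOfSingularities.Theorems.WeightedInvariantLocalWeightedDropTOT2ConflictBudgetDefs

/-!
# TOT2-LINE (P3) brick B0′: the conflict budget over the ONE-DIMENSIONAL top-locus primes (definitions)

Sub-problem `ResolutionOfSingularities`, ENGINE crux `stmt-ResolutionOfSingularities-8899` (`LocalWeightedDrop`), skeleton v35 (2e806da509994632),
registered stub `stub_conflictBudget` (P3).  [OURS · L1 W4.3 · chain w43 · res-L1-w43-stub-2 g6 (owner of (P3)); companion of B0
`…TOT2ConflictBudgetDefs` (p564344).  «[OURS · L1 W4.3] replaces the role of nothing printed; NOT a statement of the manuscript.»  AI-produced,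
gate-checked, weaker than expert review.]

WHY A SECOND INDEX SET.  The budget laws give the presentation context (hence a SQUAREFREE monic germ, hence `dim k⟦u,y⟧⧸P = 1` for every
top-locus prime) only for the state BELOW; for the successor label the kernel would have to know that squarefreeness survives the chart maps
(true, but a theorem on analytic reducedness under blowing up).  Restricting the index set of the budget to the top-locus primes WHOSE BRANCH RING
IS ONE-DIMENSIONAL makes every brick apply upstairs unconditionally (B3's first conclusion transports `dim = 1` downstairs; D3 v2 carries the
dimension binders), and changes nothing below: under the context `topPrimesD = topPrimes` (B6-basics' `ringKrullDim_eq_one_of_mem_topPrimes`).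

* `TOT2Branch.topPrimesD d A`, `TOT2Branch.topPrimesDNL d A` — top-locus primes (resp. non-line ones) with one-dimensional branch ring;
* **`TOT2Branch.conflictBudgetD d A N : ℕ`** — the budget of design v1 §2 summed over `topPrimesDNL` (same `charge`, same `pairVal`):
  THIS is the `M` of `stub_conflictBudget`.
Only definitions and unfoldings.
-/

set_option linter.dupNamespace false -- mandated namespace of this single-conjunct summit

noncomputable section

namespace Summit.ResolutionOfSingularities.ResolutionOfSingularities.Theorems

namespace TOT2Branch

open MvPowerSeries IsLocalRing

variable {k : Type} [Field k]

/-- THE ONE-DIMENSIONAL TOP-LOCUS PRIMES: top-locus primes whose branch ring `k⟦u₁,u₂,y⟧ ⧸ P` has Krull dimension one (automatic under the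
presentation context; it excludes the height-one primes of a non-squarefree germ, on which `branchVal` is junk). -/
def topPrimesD (d : ℕ) (A : Fin d → MvPowerSeries (Fin 2) k) : Set (Ideal (MvPowerSeries (Fin 3) k)) :=
  {P | P ∈ topPrimes d A ∧ ringKrullDim (MvPowerSeries (Fin 3) k ⧸ P) = 1}

/-- The non-line one-dimensional top-locus primes. -/
def topPrimesDNL (d : ℕ) (A : Fin d → MvPowerSeries (Fin 2) k) : Set (Ideal (MvPowerSeries (Fin 3) k)) :=
  {P | P ∈ topPrimesD d A ∧ (X 0 : MvPowerSeries (Fin 3) k) ∉ P ∧ (X 1 : MvPowerSeries (Fin 3) k) ∉ P}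

/-- **THE CONFLICT BUDGET over the one-dimensional top-locus primes**: `Σ_{P ∈ T°} charge(P) + 2·Σ_{P ∈ T°} Σ_{P′ ∈ T° ∖ {P}} pair(P,P′)` with
`T° = topPrimesDNL d A` (finite sums; `finsum` is `0` on an infinite support, never met by the laws). -/
def conflictBudgetD (d : ℕ) (A : Fin d → MvPowerSeries (Fin 2) k) (N : Finset (Fin 2)) : ℕ :=
  (∑ᶠ P ∈ topPrimesDNL d A, charge d A N P) + 2 * ∑ᶠ P ∈ topPrimesDNL d A, ∑ᶠ P' ∈ topPrimesDNL d A \ {P}, (pairVal P P').toNat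

/-! ## Unfoldings -/

/-- Membership in `topPrimesD`. -/
theorem mem_topPrimesD_iff {d : ℕ} {A : Fin d → MvPowerSeries (Fin 2) k} {P : Ideal (MvPowerSeries (Fin 3) k)} :
    P ∈ topPrimesD d A ↔ P ∈ topPrimes d A ∧ ringKrullDim (MvPowerSeries (Fin 3) k ⧸ P) = 1 := Iff.rfl

/-- Membership in `topPrimesDNL`. -/
theorem mem_topPrimesDNL_iff {d : ℕ} {A : Fin d → MvPowerSeries (Fin 2) k} {P : Ideal (MvPowerSeries (Fin 3) k)} :
    P ∈ topPrimesDNL d A ↔ P ∈ topPrimesD d A ∧ (X 0 : MvPowerSeries (Fin 3) k) ∉ P ∧ (X 1 : MvPowerSeries (Fin 3) k) ∉ P := Iff.rfl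

/-- `topPrimesD ⊆ topPrimes`. -/
theorem topPrimesD_subset (d : ℕ) (A : Fin d → MvPowerSeries (Fin 2) k) : topPrimesD d A ⊆ topPrimes d A := fun _ h => h.1

/-- `topPrimesDNL ⊆ topPrimesNL`. -/
theorem topPrimesDNL_subset_topPrimesNL (d : ℕ) (A : Fin d → MvPowerSeries (Fin 2) k) : topPrimesDNL d A ⊆ topPrimesNL d A :=
  fun _ h => ⟨h.1.1, h.2.1, h.2.2⟩

/-- `topPrimesDNL ⊆ topPrimesD`. -/
theorem topPrimesDNL_subset (d : ℕ) (A : Fin d → MvPowerSeries (Fin 2) k) : topPrimesDNL d A ⊆ topPrimesD d A := fun _ h => h.1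

/-- A non-line top-locus prime with one-dimensional branch ring is in `topPrimesDNL`. -/
theorem mem_topPrimesDNL_of_mem_topPrimesNL {d : ℕ} {A : Fin d → MvPowerSeries (Fin 2) k} {P : Ideal (MvPowerSeries (Fin 3) k)}
    (hP : P ∈ topPrimesNL d A) (hdim : ringKrullDim (MvPowerSeries (Fin 3) k ⧸ P) = 1) : P ∈ topPrimesDNL d A :=
  ⟨⟨hP.1, hdim⟩, hP.2.1, hP.2.2⟩

/-- `conflictBudgetD` unfolded. -/
theorem conflictBudgetD_eq (d : ℕ) (A : Fin d → MvPowerSeries (Fin 2) k) (N : Finset (Fin 2)) :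
    conflictBudgetD d A N =
      (∑ᶠ P ∈ topPrimesDNL d A, charge d A N P) + 2 * ∑ᶠ P ∈ topPrimesDNL d A, ∑ᶠ P' ∈ topPrimesDNL d A \ {P}, (pairVal P P').toNat := rfl

/-- **THE BUDGET AS `Finset` SUMS** over any finite enumeration of `topPrimesDNL`. -/
theorem conflictBudgetD_eq_sum {d : ℕ} {A : Fin d → MvPowerSeries (Fin 2) k} (hfin : (topPrimesDNL d A).Finite) (N : Finset (Fin 2)) :
    conflictBudgetD d A N =
      (∑ P ∈ hfin.toFinset, charge d A N P) + 2 * ∑ P ∈ hfin.toFinset, ∑ P' ∈ hfin.toFinset.erase P, (pairVal P P').toNat := by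
  rw [conflictBudgetD_eq, finsum_mem_eq_finite_toFinset_sum _ hfin, finsum_mem_eq_finite_toFinset_sum _ hfin]
  congr 2
  refine Finset.sum_congr rfl fun P _ => ?_
  have hfin' : (topPrimesDNL d A \ {P}).Finite := hfin.subset Set.sdiff_subset
  rw [finsum_mem_eq_finite_toFinset_sum _ hfin']
  refine Finset.sum_congr ?_ fun _ _ => rfl
  ext Q
  simp [Set.Finite.mem_toFinset, Finset.mem_erase, and_comm]

end TOT2Branch

end Summit.ResolutionOfSingularities.ResolutionOfSingularities.Theorems

end
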